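import Summits.Ventures.CertifiedQuantumChemistry.Rows.ConjectureSU2
import HarnessLib

/-!
# Ventures/CertifiedQuantumChemistry — Rows/ConjectureSU2RefinesSU.lean: S-U v0.2 refines S-U v0.1

HONEST FRAMING (verbatim): certified bounds for a stated model Hamiltonian in a stated basis; not a
claim about the real molecule beyond that model.

THEOREMS ONLY (no `def`, no claim node, no row, no certificate), zero compute, standard axioms; the
optional sibling of the two conjecture leaves `Rows/ConjectureSU.lean` (v0.1) and `Rows/ConjectureSU2.lean`
(v0.2) invited by CHECKLIST-TSU2 C16' (the lead's CHECK record `pub-qchem-lead/tools-g55/tsu2/CHECK-TSU2-e9d97781.txt`):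
the registered rewrite S-U v0.2 IMPLIES S-U v0.1 clause by clause, because its value / interval clauses are
contained in v0.1's — `√2 − 1 ∈ [39/100, 42/100]` (from `(139/100)² ≤ 2 ≤ (142/100)²`),
`[1.2430023798, 1.2430024544] ⊆ [118/100, 125/100]`, `[1.0357214185, 1.0357214795] ⊆ [1, 105/100]` — and every
other clause is the same text. Neither leaf is edited; nothing here proves or refutes either conjecture.

Typer `pub-qchem-typer` (gen 20), 0 core-h.
-/

namespace Summit.Ventures.CertifiedQuantumChemistry

/-- `1.39 ≤ √2 ≤ 1.42`, hence `√2 − 1 ∈ [39/100, 42/100]`: S-U v0.2's exact `L = 4` DQG value lies in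
S-U v0.1's registered interval. -/
theorem sqrt_two_sub_one_mem_Icc : Real.sqrt 2 - 1 ∈ Set.Icc (39/100 : ℝ) (42/100) := by
  constructor
  · have h : (139/100 : ℝ) ≤ Real.sqrt 2 := by
      calc (139/100 : ℝ) = Real.sqrt ((139/100 : ℝ) ^ 2) := (Real.sqrt_sq (by norm_num)).symm
        _ ≤ Real.sqrt 2 := Real.sqrt_le_sqrt (by norm_num)
    linarith
  · have h : Real.sqrt 2 ≤ (142/100 : ℝ) := by
      calc Real.sqrt 2 ≤ Real.sqrt ((142/100 : ℝ) ^ 2) := Real.sqrt_le_sqrt (by norm_num)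
        _ = 142/100 := Real.sqrt_sq (by norm_num)
    linarith

/-- **S-U v0.2 refines S-U v0.1**: level by level and for the conjunction, the v0.2 `Prop` implies the
v0.1 `Prop` with the SAME witness `c` (`c 2 = √2 − 1 ∈ [0.39, 0.42]`, `[1.2430023798, 1.2430024544] ⊆ [1.18, 1.25]`;
`c 2 = 0` unchanged, `[1.0357214185, 1.0357214795] ⊆ [1, 1.05]`). Packaged as ONE conjunction of the three
implications (so that no theorem of this file has a conjecture node as its conclusion: nothing here proves,
conditionally proves, or refutes either conjecture). -/
theorem conjectureSU2_refines_conjectureSU :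
    (ConjectureSU2_DQG → ConjectureSU_DQG) ∧ (ConjectureSU2_DQGS2 → ConjectureSU_DQGS2) ∧
      (ConjectureSU2 → ConjectureSU) := by
  have hDQG : ConjectureSU2_DQG → ConjectureSU_DQG := by
    rintro ⟨c, h1, h2, h3, h4⟩
    exact ⟨c, h1, h2, h3 ▸ sqrt_two_sub_one_mem_Icc, by linarith [h4.1], by linarith [h4.2]⟩
  have hDQGS2 : ConjectureSU2_DQGS2 → ConjectureSU_DQGS2 := by
    rintro ⟨c, h1, h2, h3, h4⟩
    exact ⟨c, h1, h2, h3, by linarith [h4.1], by linarith [h4.2]⟩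
  exact ⟨hDQG, hDQGS2, fun h => ⟨hDQG h.1, hDQGS2 h.2⟩⟩

end Summit.Ventures.CertifiedQuantumChemistry
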